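import Summits.NavierStokesRegularity.NavierStokesRegularity.Theorems.SqueezeCycleRecurrentLiouvilleNearIdentityDSS
import Summits.NavierStokesRegularity.NavierStokesRegularity.Theorems.SqueezeCycleRecurrentLiouvilleOrbitContinuous
import Summits.NavierStokesRegularity.NavierStokesRegularity.Theorems.RecurrentProfilesRecurrentReductionOrbit
import Mathlib.Topology.Algebra.Order.Archimedean
import HarnessLib

/-!
# Crux `RecurrentLiouville` (stmt-NavierStokesRegularity-1589), line `Sketch` (skeleton v9) — harvest
  stub H4 `stub_prScalingStabilizer`: the scaling stabiliser of a Type-I singularity model is discrete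

Theorems-only support file (no definitions, no named facts).

**Statement.**  For every rate constant `C` and bound `M < ⊤` there is `Λ = Λ(C, M) > 1` such that
for every suitable weak solution `(u, p)` of Navier–Stokes (`ν = 1`, `f = 0`) on the backward slab
`ℝ₋ × ℝ³` with weak gradient `G`, Albritton–Barker quantity `𝐈(ℝ³ × ℝ₋) ≤ M`, the Type-I rate
`‖u(t, x)‖ ≤ C/√(−t)` and a SINGULAR space–time origin, the SCALING STABILISER

  `Stab(u) = {σ : ℝ | u_{e^σ} = u a.e. on the slab}`,  `u_λ(t, x) = λ u(λ² t, λ x)` (`nsRescale λ u`),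

is a discrete subgroup of `ℝ`: either trivial (`σ ∈ Stab(u) → σ = 0`), or `σ₀ ℤ` for some
`σ₀ ≥ log Λ`.  In words: an almost-everywhere discretely self-similar Type-I singularity model has a
LEAST factor `λ₀ = e^{σ₀} ≥ Λ(C, M)`, every factor is an integer power of it, and two incommensurable
factors never occur (they would force regularity).

**Proof.**  `Stab(u)` is an additive subgroup of `ℝ` (`prStab_exists_addSubgroup`: scaling by
`e^τ` transports a.e. identities on the slab, `rlNearIdentityDSS_ae_comp_dilation`, and inverts,
`rlNearIdentityDSS_ae_inv`).  It is CLOSED (`prStab_isSeqClosed`): if `σₙ → σ` with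
`u_{e^{σₙ}} = u` a.e., then on every backward ball `Q(0, R)`
`‖u_{e^σ} − u‖_{L³(Q(0,R))} = ‖u_{e^σ} − u_{e^{σₙ}}‖_{L³(Q(0,R))} = K(e^σ) ‖u_{e^{σₙ−σ}} − u‖_{L³(Q(0, e^σ R))} → 0`
by the exact scaling law (`eLpNorm_zoom_sub_zoom`) and the continuity of the scaling orbit in `L³`
on the balls (`stub_rlOrbitContinuous`, fed with `memLp_three_of_slabProfile`); so `u_{e^σ} = u`
a.e. on every ball, hence on the slab.  By Mathlib's `AddSubgroup.dense_or_cyclic` the stabiliser is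
dense or cyclic.  Dense and closed means all of `ℝ`, so `u` is a.e. `λ`-DSS with
`λ = e^{(log Λ)/2} ∈ (1, Λ)` and regular at the origin by the near-identity DSS rung
`stub_rlNearIdentityDSS` — contradicting the singular origin.  Cyclic with generator `0` is the
trivial alternative; cyclic with generator `a ≠ 0` is `|a| ℤ` (`prStab_mem_closure_singleton_iff_abs`),
and `|a| ≥ log Λ` because `|a| ∈ Stab(u)` with `0 < |a| < log Λ` would again make `u` regular by the
rung.

## References

* D. Chae, J. Wolf, Comm. PDE 42 (2017), Thm 1.3 (= arXiv:1610.09464). [ChaeWolf2017RemovingDSS]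
* D. Albritton, T. Barker, J. Math. Fluid Mech. 21 (2019) no. 43 = arXiv:1811.00502, Lemma 2.2,
  Prop. 2.3. [AlbrittonBarker2019]
-/

noncomputable section

-- the sub-problem namespace repeats the summit name (D-0017 layout `Summit.<S>.<P>.Theorems`)
set_option linter.dupNamespace false

namespace Summit.NavierStokesRegularity.NavierStokesRegularity.Theorems

open MeasureTheory Set Function Filter Topology TopologicalSpace Metric
open Literature.Analysis Literature.Analysis.FluidPDE
open scoped NNReal ENNReal

/-- **The scaling stabiliser is an additive subgroup of `ℝ`.**  For every field `u` on `ℝ × ℝ³`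
there is an additive subgroup of `ℝ` whose members are exactly the log-scales `σ` with
`u_{e^σ} = u` almost everywhere on the backward slab: `e^0 = 1` acts trivially, the identity for
`σ` transported along the dilation by `e^τ` composes with the identity for `τ`
(`e^{σ+τ} = e^σ e^τ`, `nsRescale_mul`), and an a.e. self-similarity inverts
(`rlNearIdentityDSS_ae_inv`, `e^{−σ} = (e^σ)⁻¹`). [folklore] -/
theorem prStab_exists_addSubgroup
    (u : ℝ → EuclideanSpace ℝ (Fin 3) → EuclideanSpace ℝ (Fin 3)) :
    ∃ S : AddSubgroup ℝ, ∀ σ : ℝ, σ ∈ S ↔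
      ∀ᵐ z ∂(volume.restrict (Iio (0 : ℝ) ×ˢ (univ : Set (EuclideanSpace ℝ (Fin 3))))),
        nsRescale (Real.exp σ) u z.1 z.2 = u z.1 z.2 := by
  -- `e^0 = 1`
  have h0 : ∀ᵐ z ∂(volume.restrict (Iio (0 : ℝ) ×ˢ (univ : Set (EuclideanSpace ℝ (Fin 3))))),
      nsRescale (Real.exp 0) u z.1 z.2 = u z.1 z.2 :=
    Eventually.of_forall fun z => by rw [Real.exp_zero, nsRescale_one]
  -- transport `u_{e^σ} = u` along the dilation by `e^τ`, then use `u_{e^τ} = u`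
  have hadd : ∀ {σ τ : ℝ},
      (∀ᵐ z ∂(volume.restrict (Iio (0 : ℝ) ×ˢ (univ : Set (EuclideanSpace ℝ (Fin 3))))),
        nsRescale (Real.exp σ) u z.1 z.2 = u z.1 z.2) →
      (∀ᵐ z ∂(volume.restrict (Iio (0 : ℝ) ×ˢ (univ : Set (EuclideanSpace ℝ (Fin 3))))),
        nsRescale (Real.exp τ) u z.1 z.2 = u z.1 z.2) →
      ∀ᵐ z ∂(volume.restrict (Iio (0 : ℝ) ×ˢ (univ : Set (EuclideanSpace ℝ (Fin 3))))),
        nsRescale (Real.exp (σ + τ)) u z.1 z.2 = u z.1 z.2 := by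
    intro σ τ hσ hτ
    have ht := rlNearIdentityDSS_ae_comp_dilation (F := fun z => nsRescale (Real.exp σ) u z.1 z.2)
      (G := fun z => u z.1 z.2) (Real.exp_pos τ) hσ
    filter_upwards [ht, hτ] with z hz hz'
    rw [Real.exp_add, nsRescale_mul, nsRescale_apply, hz, ← nsRescale_apply, hz']
  -- invert `u_{e^σ} = u`: `e^{-σ} = (e^σ)⁻¹`
  have hneg : ∀ {σ : ℝ},
      (∀ᵐ z ∂(volume.restrict (Iio (0 : ℝ) ×ˢ (univ : Set (EuclideanSpace ℝ (Fin 3))))),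
        nsRescale (Real.exp σ) u z.1 z.2 = u z.1 z.2) →
      ∀ᵐ z ∂(volume.restrict (Iio (0 : ℝ) ×ˢ (univ : Set (EuclideanSpace ℝ (Fin 3))))),
        nsRescale (Real.exp (-σ)) u z.1 z.2 = u z.1 z.2 := by
    intro σ hσ
    have h := rlNearIdentityDSS_ae_inv (Real.exp_pos σ) hσ
    rw [← Real.exp_neg] at h
    exact h
  refine ⟨{ carrier := ({σ : ℝ | ∀ᵐ (z : ℝ × EuclideanSpace ℝ (Fin 3))
                ∂(volume.restrict (Iio (0 : ℝ) ×ˢ (univ : Set (EuclideanSpace ℝ (Fin 3))))),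
                  nsRescale (Real.exp σ) u z.1 z.2 = u z.1 z.2} : Set ℝ),
             zero_mem' := h0,
             add_mem' := fun hσ hτ => hadd hσ hτ,
             neg_mem' := fun hσ => hneg hσ }, fun σ => Iff.rfl⟩

/-- **The scaling stabiliser is closed** (sequentially, hence topologically).  If `u` lies in
`L³(Q(0, R))` for every `R > 0`, `σₙ → σ` and `u_{e^{σₙ}} = u` a.e. on the slab for every `n`, then
`u_{e^σ} = u` a.e. on the slab: on each ball
`‖u_{e^σ} − u‖_{L³(Q(0,R))} = ‖u_{e^σ} − u_{e^{σₙ}}‖_{L³(Q(0,R))} = K(e^σ) ‖u_{e^{σₙ−σ}} − u‖_{L³(Q(0, e^σ R))}`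
(a.e. equality on the ball; `e^{σₙ} = e^{σₙ−σ} e^σ`, `nsRescale_mul`, exact scaling law
`eLpNorm_zoom_sub_zoom`), which tends to `0` by the continuity of the scaling orbit
(`stub_rlOrbitContinuous`) since `e^{σₙ−σ} → 1`; so the constant left-hand side vanishes, `u_{e^σ} = u`
a.e. on every `Q(0, n+1)`, and these balls exhaust the slab. [folklore] -/
theorem prStab_isSeqClosed
    {u : ℝ → EuclideanSpace ℝ (Fin 3) → EuclideanSpace ℝ (Fin 3)}
    (hu : ∀ R : ℝ, 0 < R → MemLp (uncurry u) 3
      (volume.restrict (parabolicCylinder R (0 : ℝ × EuclideanSpace ℝ (Fin 3))))) :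
    IsSeqClosed {σ : ℝ |
      ∀ᵐ z ∂(volume.restrict (Iio (0 : ℝ) ×ˢ (univ : Set (EuclideanSpace ℝ (Fin 3))))),
        nsRescale (Real.exp σ) u z.1 z.2 = u z.1 z.2} := by
  intro x σ hx hxσ
  have hx' : ∀ n, ∀ᵐ z ∂(volume.restrict (Iio (0 : ℝ) ×ˢ (univ : Set (EuclideanSpace ℝ (Fin 3))))),
      nsRescale (Real.exp (x n)) u z.1 z.2 = u z.1 z.2 := hx
  show ∀ᵐ z ∂(volume.restrict (Iio (0 : ℝ) ×ˢ (univ : Set (EuclideanSpace ℝ (Fin 3))))),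
    nsRescale (Real.exp σ) u z.1 z.2 = u z.1 z.2
  -- S6: the orbit of `u` is continuous in `L³` on the balls
  have horbit := stub_rlOrbitContinuous u hu
  -- measurability of the rescaled fields on the balls
  have hmeas : ∀ c : ℝ, 0 < c → ∀ R : ℝ, 0 < R →
      AEStronglyMeasurable (uncurry (nsRescale c u))
        (volume.restrict (parabolicCylinder R (0 : ℝ × EuclideanSpace ℝ (Fin 3)))) := by
    intro c hc R hR
    rw [nsRescale_eq_zoom c u]
    exact (memLp_three_zoom hc (hu (c * R) (by positivity))).1
  have he : 0 < Real.exp σ := Real.exp_pos σ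
  -- the scales `r_n = e^{x_n - σ} → 1`
  set r : ℕ → ℝ := fun n => Real.exp (x n - σ) with hr
  have hr1 : Tendsto r atTop (𝓝 1) := by
    have h := (Real.continuous_exp.tendsto (σ - σ)).comp (hxσ.sub_const σ)
    rw [sub_self, Real.exp_zero] at h
    exact h
  have hxr : ∀ n, Real.exp (x n) = r n * Real.exp σ := by
    intro n
    rw [hr]
    dsimp only
    rw [← Real.exp_add, sub_add_cancel]
  -- on every ball `u_{e^σ} = u` a.e.
  have hball : ∀ R : ℝ, 0 < R →
      ∀ᵐ z ∂(volume.restrict (parabolicCylinder R (0 : ℝ × EuclideanSpace ℝ (Fin 3)))),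
        nsRescale (Real.exp σ) u z.1 z.2 = u z.1 z.2 := by
    intro R hR
    set μR : Measure (ℝ × EuclideanSpace ℝ (Fin 3)) :=
      volume.restrict (parabolicCylinder R (0 : ℝ × EuclideanSpace ℝ (Fin 3))) with hμR
    set F : ℝ × EuclideanSpace ℝ (Fin 3) → EuclideanSpace ℝ (Fin 3) :=
      uncurry (nsRescale (Real.exp σ) u) with hF
    set Gn : ℕ → ℝ × EuclideanSpace ℝ (Fin 3) → EuclideanSpace ℝ (Fin 3) :=
      fun n => uncurry (nsRescale (Real.exp (x n)) u) with hGn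
    have hFm : AEStronglyMeasurable F μR := hmeas _ he R hR
    have hum : AEStronglyMeasurable (uncurry u) μR := (hu R hR).1
    -- `G_n = u` a.e. on the ball
    have hGae : ∀ n, Gn n =ᵐ[μR] uncurry u := fun n =>
      ae_restrict_of_ae_restrict_of_subset (parabolicCylinder_origin_subset_slab R) (hx' n)
    -- so the distance from `F` to `u` is the distance from `F` to `G_n` ...
    have hdist : ∀ n, eLpNorm (F - uncurry u) 3 μR = eLpNorm (F - Gn n) 3 μR := fun n =>
      eLpNorm_congr_ae ((EventuallyEq.refl _ F).sub (hGae n).symm)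
    -- ... which is `K(e^σ) ‖u_{r_n} - u‖_{L³(Q(0, e^σ R))} → 0`
    have heq : ∀ n, eLpNorm (F - Gn n) 3 μR =
        ‖Real.exp σ‖ₑ * (ENNReal.ofReal (Real.exp σ ^ 2 * Real.exp σ ^ 3)⁻¹) ^ (1 / (3 : ℝ≥0∞).toReal) *
          eLpNorm (uncurry (nsRescale (r n) u) - uncurry u) 3
            (volume.restrict (parabolicCylinder (Real.exp σ * R) (0 : ℝ × EuclideanSpace ℝ (Fin 3)))) := by
      intro n
      rw [hF, hGn, hμR]
      dsimp only
      rw [hxr n, nsRescale_mul, nsRescale_eq_zoom (Real.exp σ) u,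
        nsRescale_eq_zoom (Real.exp σ) (nsRescale (r n) u), eLpNorm_zoom_sub_zoom _ _ he R,
        eLpNorm_sub_comm]
    have hlim : Tendsto (fun n => eLpNorm (F - Gn n) 3 μR) atTop (𝓝 0) := by
      simp_rw [heq]
      have hRσ : 0 < Real.exp σ * R := by positivity
      have h := ENNReal.Tendsto.const_mul ((horbit (Real.exp σ * R) hRσ).comp hr1)
        (Or.inr (zoomConst_ne_top (Real.exp σ)))
        (a := ‖Real.exp σ‖ₑ * (ENNReal.ofReal (Real.exp σ ^ 2 * Real.exp σ ^ 3)⁻¹) ^ (1 / (3 : ℝ≥0∞).toReal))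
      rw [mul_zero] at h
      simpa only [Function.comp_def] using h
    have h0 : eLpNorm (F - uncurry u) 3 μR = 0 :=
      tendsto_const_nhds_iff.1 ((tendsto_congr hdist).2 hlim)
    rw [eLpNorm_eq_zero_iff (hFm.sub hum) (by norm_num)] at h0
    filter_upwards [h0] with z hz
    rw [Pi.sub_apply, Pi.zero_apply, sub_eq_zero] at hz
    exact hz
  -- the balls `Q(0, n+1)` exhaust the slab
  refine ae_restrict_of_ae_restrict_of_subset lowerHalf_subset_iUnion_parabolicCylinder ?_
  rw [ae_restrict_iUnion_iff]
  intro n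
  exact hball _ (by positivity)

-- adapted from `RssStratumStabilizer.mem_closure_singleton_iff_abs` (TypeICertificateLadderTargetRssStratumStabilizer)
/-- Membership in a cyclic subgroup `ℤ a` of `ℝ` with `a ≠ 0` is membership in `ℤ |a|`
(replace `k` by `−k` if `a < 0`). [folklore] -/
theorem prStab_mem_closure_singleton_iff_abs {a : ℝ} (ha : a ≠ 0) (σ : ℝ) :
    σ ∈ AddSubgroup.closure ({a} : Set ℝ) ↔ ∃ k : ℤ, σ = (k : ℝ) * |a| := by
  rw [AddSubgroup.mem_closure_singleton]
  simp only [zsmul_eq_mul]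
  rcases lt_or_gt_of_ne ha with hneg | hpos
  · rw [abs_of_neg hneg]
    constructor
    · rintro ⟨k, hk⟩
      exact ⟨-k, by rw [Int.cast_neg]; linear_combination -hk⟩
    · rintro ⟨k, hk⟩
      exact ⟨-k, by rw [Int.cast_neg]; linear_combination -hk⟩
  · rw [abs_of_pos hpos]
    constructor
    · rintro ⟨k, hk⟩
      exact ⟨k, hk.symm⟩
    · rintro ⟨k, hk⟩
      exact ⟨k, hk.symm⟩

/-- **H4 · DISCRETE SCALING STABILISER.**  For every rate constant `C` and bound `M < ⊤` there is
`Λ > 1` such that for every suitable weak slab solution `(u, p)` with weak gradient `G`, `𝐈 ≤ M`,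
rate `C` and a SINGULAR origin, the set of log-scales `σ` with `u_{e^σ} = u` a.e. on the slab is
either `{0}` or `σ₀ℤ` for some `σ₀ ≥ log Λ`: an a.e.-discretely-self-similar Type-I singularity
model has a LEAST factor `λ₀ = e^{σ₀} ≥ Λ(C,M)` of which every factor is an integer power, and two
incommensurable factors never occur.  Proof: the stabiliser is an additive subgroup of `ℝ`
(`prStab_exists_addSubgroup`), CLOSED (`prStab_isSeqClosed`: continuity of the scaling orbit in
every `L³(Q(0,R))`, `stub_rlOrbitContinuous`, and the exact scaling law), not dense (a dense closed
subgroup is `ℝ`, so `u` would be a.e. `λ`-DSS for `λ = e^{(log Λ)/2} ∈ (1, Λ)` and regular by the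
near-identity DSS rung `stub_rlNearIdentityDSS`), hence cyclic (`AddSubgroup.dense_or_cyclic`), and
a nonzero generator has `|a| ≥ log Λ` by the same rung.
[cite: ChaeWolf2017RemovingDSS, Thm 1.3; AlbrittonBarker2019, Lemma 2.2, Prop. 2.3] -/
theorem stub_prScalingStabilizer :
    ∀ (C : ℝ) (M : ℝ≥0∞), M < ⊤ → ∃ Λ : ℝ, 1 < Λ ∧
      ∀ (u : ℝ → EuclideanSpace ℝ (Fin 3) → EuclideanSpace ℝ (Fin 3))
        (p : ℝ → EuclideanSpace ℝ (Fin 3) → ℝ)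
        (G : ℝ → EuclideanSpace ℝ (Fin 3) → EuclideanSpace ℝ (Fin 3) →L[ℝ] EuclideanSpace ℝ (Fin 3)),
        IsSuitableWeakSolutionOn (slab (EuclideanSpace ℝ (Fin 3)) (Iio 0) isOpen_Iio) 1 0 u p →
        HasWeakSpatialGradientOn (slab (EuclideanSpace ℝ (Fin 3)) (Iio 0) isOpen_Iio) u G →
        typeIBound (Iio (0 : ℝ) ×ˢ univ) u p G ≤ M →
        HasTypeITimeDecay C u →
        IsBackwardSingularPoint u 0 →
        (∀ σ : ℝ, (∀ᵐ z ∂(volume.restrict (Iio (0 : ℝ) ×ˢ (univ : Set (EuclideanSpace ℝ (Fin 3))))),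
            nsRescale (Real.exp σ) u z.1 z.2 = u z.1 z.2) → σ = 0) ∨
        (∃ σ₀ : ℝ, Real.log Λ ≤ σ₀ ∧ ∀ σ : ℝ,
            (∀ᵐ z ∂(volume.restrict (Iio (0 : ℝ) ×ˢ (univ : Set (EuclideanSpace ℝ (Fin 3))))),
              nsRescale (Real.exp σ) u z.1 z.2 = u z.1 z.2) ↔ ∃ k : ℤ, σ = (k : ℝ) * σ₀) := by
  intro C M hM
  obtain ⟨Λ, hΛ1, hΛ⟩ := stub_rlNearIdentityDSS C M hM
  refine ⟨Λ, hΛ1, ?_⟩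
  intro u p G hsw hwg hI hdec hsing
  have hI' : typeIBound (Iio (0 : ℝ) ×ˢ univ) u p G < ⊤ := lt_of_le_of_lt hI hM
  have hu : ∀ R : ℝ, 0 < R → MemLp (uncurry u) 3
      (volume.restrict (parabolicCylinder R (0 : ℝ × EuclideanSpace ℝ (Fin 3)))) :=
    fun R hR => memLp_three_of_slabProfile hwg hI' hR
  -- the rung: no log-factor in `(0, log Λ)` (the model is singular)
  have hno : ∀ σ : ℝ, 0 < σ → σ < Real.log Λ →
      ¬ (∀ᵐ z ∂(volume.restrict (Iio (0 : ℝ) ×ˢ (univ : Set (EuclideanSpace ℝ (Fin 3))))),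
          nsRescale (Real.exp σ) u z.1 z.2 = u z.1 z.2) := by
    intro σ hσ0 hσΛ hS
    have h1 : 1 < Real.exp σ := lt_of_eq_of_lt Real.exp_zero.symm (Real.exp_lt_exp.2 hσ0)
    have h2 : Real.exp σ < Λ := by
      have h := Real.exp_lt_exp.2 hσΛ
      rwa [Real.exp_log (zero_lt_one.trans hΛ1)] at h
    exact hΛ (Real.exp σ) h1 h2 u p G hsw hwg hI hdec hS hsing
  -- the stabiliser as a closed additive subgroup of `ℝ`
  obtain ⟨S, hS⟩ := prStab_exists_addSubgroup u
  have hcoe : (S : Set ℝ) = {σ : ℝ |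
      ∀ᵐ z ∂(volume.restrict (Iio (0 : ℝ) ×ˢ (univ : Set (EuclideanSpace ℝ (Fin 3))))),
        nsRescale (Real.exp σ) u z.1 z.2 = u z.1 z.2} := Set.ext fun σ => hS σ
  have hclosed : IsClosed (S : Set ℝ) := by
    rw [hcoe]
    exact (prStab_isSeqClosed hu).isClosed
  rcases AddSubgroup.dense_or_cyclic S with hd | ⟨a, ha⟩
  · -- dense and closed: the stabiliser is `ℝ`, so `(log Λ)/2` is a log-factor in `(0, log Λ)`
    exfalso
    have huniv : (S : Set ℝ) = univ := by rw [← hclosed.closure_eq, hd.closure_eq]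
    have hlog : 0 < Real.log Λ := Real.log_pos hΛ1
    have hmem : Real.log Λ / 2 ∈ S := by
      rw [← SetLike.mem_coe, huniv]
      exact mem_univ _
    exact hno (Real.log Λ / 2) (half_pos hlog) (half_lt_self hlog) ((hS _).1 hmem)
  · by_cases ha0 : a = 0
    · -- trivial stabiliser
      left
      intro σ hσ
      have h := (hS σ).2 hσ
      rw [ha, ha0, AddSubgroup.mem_closure_singleton] at h
      obtain ⟨n, hn⟩ := h
      rw [smul_zero] at hn
      exact hn.symm
    · -- infinite cyclic stabiliser `|a| ℤ`, and `|a| ≥ log Λ` by the rung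
      right
      refine ⟨|a|, ?_, fun σ => (hS σ).symm.trans ?_⟩
      · refine le_of_not_gt fun hlt => ?_
        have haS : a ∈ S := by
          rw [ha]
          exact AddSubgroup.mem_closure_singleton.2 ⟨1, one_zsmul a⟩
        have habsS : |a| ∈ S := by
          rcases abs_choice a with h | h <;> rw [h]
          · exact haS
          · exact S.neg_mem haS
        exact hno |a| (abs_pos.2 ha0) hlt ((hS _).1 habsS)
      · rw [ha]
        exact prStab_mem_closure_singleton_iff_abs ha0 σ

end Summit.NavierStokesRegularity.NavierStokesRegularity.Theorems

end
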